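import Summits.CriticalPhenomena.Ising3D.TaylorTableOddHeadParts2Sound
import HarnessLib

/-!
# XXXId: `term2_sound`, `termVal2`, `slice2_sound`
(cell `pub-ising3x`, seat boot-1 gen 15/16; the MERGED-2 (first-order) odd-head test chain, landed per LEAN-PLAN-MERGED2 in ten modules)

HONEST FRAMING: lottery ticket; floor = tightest certified 3D Ising CFT bounds; no exact-solution
claim without a proof. Island framing: certified exclusion region at stated derivative order and
assumptions; not a determination of the 3D Ising critical exponents beyond that.

Drafted and kernel-checked as one combined file (oddtest2/lean-draft/Merged2CellCombined.lean, 83 theorems, standard axioms); landed in slices of ≤ 400 lines. [folklore]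
-/

namespace Summit.CriticalPhenomena.Ising3D

open Finset Set
open Literature.Analysis.ValidatedNumerics Literature.Analysis.ValidatedNumerics.PolyMP
open Literature.Analysis.ValidatedNumerics.NumericsMP
open Literature.MathematicalPhysics.QuantumFieldTheory.ConformalBootstrap3D
open Literature.MathematicalPhysics.QuantumFieldTheory.ConformalBootstrap3D.HRTM
open Literature.MathematicalPhysics.QuantumFieldTheory.ConformalBootstrap3D.PointKernel (mulQ mem_mulQ legendreLamQ)

namespace HeadParts2

open HRTMAB2 (T3 rowEntry2)

/-! ### `term2_sound` (LEAN-PLAN item 2): the per-term decomposition `t_q = B₀(ρ) + x·B_x(ρ) + y·B_y(ρ) + R_q` -/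

/-- `|x| ≤ |I|/S` from membership. [folklore] -/
theorem abs_le_aH {S : ℕ} (hS : 0 < S) {x : ℝ} {I : MI} (h : MI.mem S x I) : |x| ≤ ((aH S I : ℚ) : ℝ) := by
  have h1 := MI.abs_le_absHi h
  have hSr : (0 : ℝ) < S := by exact_mod_cast hS
  unfold aH; push_cast
  rw [le_div_iff₀ hSr]; exact h1

/-- Five-term weighted triangle inequality (bookkeeping). [folklore] -/
theorem abs_comb5 {w R3 R4 R5 R0 Rt B3 B4 B5 B0 Bt D : ℝ} (hw : 0 ≤ w) (h3 : |R3| ≤ B3) (h4 : |R4| ≤ B4)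
    (h5 : |R5| ≤ B5) (h0 : |R0| ≤ B0) (ht : |Rt| ≤ Bt) (hD : D = w * (R3 + R4 - R5 + R0 + Rt)) :
    |D| ≤ w * (B3 + B4 + B5 + B0 + Bt) := by
  rw [hD, abs_mul, abs_of_nonneg hw]
  refine mul_le_mul_of_nonneg_left ?_ hw
  rw [abs_le] at h3 h4 h5 h0 ht ⊢
  constructor <;> linarith [h3.1, h4.1, h5.1, h0.1, ht.1, h3.2, h4.2, h5.2, h0.2, ht.2]

/-- [folklore] -/ theorem proj5_zero {α : Type*} (T : α × α × α × α × α) : proj5 T 0 = T.1 := rfl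
/-- [folklore] -/ theorem proj5_one {α : Type*} (T : α × α × α × α × α) : proj5 T 1 = T.2.1 := rfl
/-- [folklore] -/ theorem proj5_two {α : Type*} (T : α × α × α × α × α) : proj5 T 2 = T.2.2.1 := rfl
/-- [folklore] -/ theorem proj5_three {α : Type*} (T : α × α × α × α × α) : proj5 T 3 = T.2.2.2.1 := rfl
/-- [folklore] -/ theorem proj5_four {α : Type*} (T : α × α × α × α × α) : proj5 T 4 = T.2.2.2.2 := rfl

/-- **Soundness of `term2`** (pointwise in the box point `(x, y) = (δσ, δε)` and the cell variable `ρ`). Inputs: the five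
literal real triples of row `j = q.2` (members of `R.lit j`), the three tables' `τ⁰/τ¹` lists and folded `τ²` lists at
`τ = x − y` (members of the `t3split` columns — what `HRTMAB2.tmem_rows2` + `tpmem_split` + `pmem_t3bound` deliver), the centre
scalars `κc ∈ K`, `C0c ∈ C0`, `Ctc ∈ Ct` with `ln2·κc ∈ dK`, `2ln2·C0c ∈ dC0x`, `2ln2·Ctc ∈ dCty`, and `2W ln 2 ≤ U ≤ 1`,
`Wσ, Wε ≤ W`. Output: member lists of the four polynomials of `term2 … q` (remainder list nonnegative) with
`t_q(x, y, ρ) = B₀(ρ) + x B_x(ρ) + y B_y(ρ) + R_q`, `|R_q| ≤ remAbsR rs |ρ|`, where `t_q` is the weighted sum of the five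
family products `c_f(x,y) · l_f(δ_f, ρ) · e_f(τ, ρ)` (literal orders shifted to the level centre `n + ctr`). [folklore] -/
theorem term2_sound {R : OddHeadRowsΔ} (hS : 0 < R.S) {C : EvenCellTM} {TS TP TM : List (List HRTMAB2.TPoly)} {sc : Scal2}
    {Wn : ℤ} {Wd : ℕ} {q : ℕ × ℕ}
    {r3 r4 r5 r0 rt : List ℝ × List ℝ × List ℝ}
    (h3 : PMem3 R.S r3 (R.lit q.2).1) (h4 : PMem3 R.S r4 (R.lit q.2).2.1) (h5 : PMem3 R.S r5 (R.lit q.2).2.2.1)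
    (h0 : PMem3 R.S r0 (R.lit q.2).2.2.2.1) (ht : PMem3 R.S rt (R.lit q.2).2.2.2.2)
    {x y : ℝ} (hx : |x| ≤ R.Wσ) (hy : |y| ≤ R.Wε)
    {eS0 eS1 eS2 eP0 eP1 eP2 eM0 eM1 eM2 : List ℝ}
    (mS0 : PMem R.S eS0 (t3split Wn Wd (rowEntry2 TS C.nF q.1 q.2)).1)
    (mS1 : PMem R.S eS1 (t3split Wn Wd (rowEntry2 TS C.nF q.1 q.2)).2.1)
    (mS2 : PMem R.S (eS2.map fun c => |c| * (x - y) ^ 2) (t3split Wn Wd (rowEntry2 TS C.nF q.1 q.2)).2.2)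
    (mP0 : PMem R.S eP0 (t3split Wn Wd (rowEntry2 TP C.nF q.1 q.2)).1)
    (mP1 : PMem R.S eP1 (t3split Wn Wd (rowEntry2 TP C.nF q.1 q.2)).2.1)
    (mP2 : PMem R.S (eP2.map fun c => |c| * (x - y) ^ 2) (t3split Wn Wd (rowEntry2 TP C.nF q.1 q.2)).2.2)
    (mM0 : PMem R.S eM0 (t3split Wn Wd (rowEntry2 TM C.nF q.1 q.2)).1)
    (mM1 : PMem R.S eM1 (t3split Wn Wd (rowEntry2 TM C.nF q.1 q.2)).2.1)
    (mM2 : PMem R.S (eM2.map fun c => |c| * (x - y) ^ 2) (t3split Wn Wd (rowEntry2 TM C.nF q.1 q.2)).2.2)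
    {κc C0c Ctc : ℝ} (hK : MI.mem R.S κc sc.K) (hdK : MI.mem R.S (Real.log 2 * κc) sc.dK)
    (hC0 : MI.mem R.S C0c sc.C0) (hdC0 : MI.mem R.S (2 * Real.log 2 * C0c) sc.dC0x)
    (hCt : MI.mem R.S Ctc sc.Ct) (hdCt : MI.mem R.S (2 * Real.log 2 * Ctc) sc.dCty)
    {W : ℝ} (hWs : (R.Wσ : ℝ) ≤ W) (hWe : (R.Wε : ℝ) ≤ W) (hU : 2 * W * Real.log 2 ≤ sc.U) (hU1 : (sc.U : ℝ) ≤ 1)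
    (ρ : ℝ) :
    ∃ b0s bxs bys rs : List ℝ,
      PMem R.S b0s (term2 R C TS TP TM sc Wn Wd q).1 ∧ PMem R.S bxs (term2 R C TS TP TM sc Wn Wd q).2.1 ∧
      PMem R.S bys (term2 R C TS TP TM sc Wn Wd q).2.2.1 ∧ PMem R.S rs (term2 R C TS TP TM sc Wn Wd q).2.2.2 ∧
      (∀ r ∈ rs, 0 ≤ r) ∧
      abs ((((1 / (legendreLamQ C.ℓ * 2 ^ q.1) : ℚ) : ℝ) *
          ((κc * (((-1 : ℤ) ^ C.ℓ : ℤ) : ℝ) * Real.exp (Real.log 2 * (x - y))) *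
              (evalR (shiftR r3.1 (((q.1 : ℚ) + C.ctr : ℚ) : ℝ)) ρ
                + (x + y) / 2 * evalR (shiftR r3.2.1 (((q.1 : ℚ) + C.ctr : ℚ) : ℝ)) ρ
                + ((x + y) / 2) ^ 2 * evalR (shiftR r3.2.2 (((q.1 : ℚ) + C.ctr : ℚ) : ℝ)) ρ) *
              (evalR eS0 ρ + (x - y) * evalR eS1 ρ + (x - y) ^ 2 * evalR eS2 ρ)
            + ((evalR (shiftR r4.1 (((q.1 : ℚ) + C.ctr : ℚ) : ℝ)) ρ
                + x * evalR (shiftR r4.2.1 (((q.1 : ℚ) + C.ctr : ℚ) : ℝ)) ρ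
                + x ^ 2 * evalR (shiftR r4.2.2 (((q.1 : ℚ) + C.ctr : ℚ) : ℝ)) ρ)
              - (evalR (shiftR r5.1 (((q.1 : ℚ) + C.ctr : ℚ) : ℝ)) ρ
                + x * evalR (shiftR r5.2.1 (((q.1 : ℚ) + C.ctr : ℚ) : ℝ)) ρ
                + x ^ 2 * evalR (shiftR r5.2.2 (((q.1 : ℚ) + C.ctr : ℚ) : ℝ)) ρ)) *
              (evalR eP0 ρ + (x - y) * evalR eP1 ρ + (x - y) ^ 2 * evalR eP2 ρ)
            + (C0c * Real.exp (2 * Real.log 2 * x)) * evalR (shiftR r0.1 (((q.1 : ℚ) + C.ctr : ℚ) : ℝ)) ρ *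
              (evalR eM0 ρ + (x - y) * evalR eM1 ρ + (x - y) ^ 2 * evalR eM2 ρ)
            + (Ctc * Real.exp (2 * Real.log 2 * y)) *
              (evalR (shiftR rt.1 (((q.1 : ℚ) + C.ctr : ℚ) : ℝ)) ρ
                + (x - y) * evalR (shiftR rt.2.1 (((q.1 : ℚ) + C.ctr : ℚ) : ℝ)) ρ
                + (x - y) ^ 2 * evalR (shiftR rt.2.2 (((q.1 : ℚ) + C.ctr : ℚ) : ℝ)) ρ) *
              (evalR eP0 ρ + (x - y) * evalR eP1 ρ + (x - y) ^ 2 * evalR eP2 ρ))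
        - (evalR b0s ρ + x * evalR bxs ρ + y * evalR bys ρ))) ≤ remAbsR rs |ρ| := by
  -- constants
  have hln2 : 0 < Real.log 2 := Real.log_pos (by norm_num)
  have hWσ0 : (0 : ℝ) ≤ R.Wσ := le_trans (abs_nonneg _) hx
  have hWε0 : (0 : ℝ) ≤ R.Wε := le_trans (abs_nonneg _) hy
  have hW0 : 0 ≤ W := le_trans hWσ0 hWs
  have hU0 : (0 : ℝ) ≤ sc.U := le_trans (by positivity) hU
  set sgn : ℤ := (-1) ^ C.ℓ with hsgn
  set cq : ℝ := (((q.1 : ℚ) + C.ctr : ℚ) : ℝ) with hcq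
  have hw0 : (0 : ℝ) ≤ (((1 / (legendreLamQ C.ℓ * 2 ^ q.1)) : ℚ) : ℝ) := by
    push_cast; rw [PointKernel.cast_legendreLamQ]
    exact div_nonneg zero_le_one (mul_nonneg (legendreLam_pos C.ℓ).le (pow_nonneg (by norm_num) _))
  have hsh : MI.mem R.S cq (PolyMP.ofRat R.S ((q.1 : ℚ) + C.ctr)) := PolyMP.mem_ofRat R.S _
  -- shifted literal lists (family index as in `R.rows`: 3↦0, 4↦1, 5↦2, 0↦3, t↦4; order 0/1/2)
  have pl30 := pmem_shiftI hS hsh h3.fst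
  have pl31 := pmem_shiftI hS hsh h3.snd
  have pl32 := pmem_shiftI hS hsh h3.thd
  have pl40 := pmem_shiftI hS hsh h4.fst
  have pl41 := pmem_shiftI hS hsh h4.snd
  have pl42 := pmem_shiftI hS hsh h4.thd
  have pl50 := pmem_shiftI hS hsh h5.fst
  have pl51 := pmem_shiftI hS hsh h5.snd
  have pl52 := pmem_shiftI hS hsh h5.thd
  have pl00 := pmem_shiftI hS hsh h0.fst
  have pl01 := pmem_shiftI hS hsh h0.snd
  have pl02 := pmem_shiftI hS hsh h0.thd
  have plt0 := pmem_shiftI hS hsh ht.fst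
  have plt1 := pmem_shiftI hS hsh ht.snd
  have plt2 := pmem_shiftI hS hsh ht.thd
  -- scalar memberships
  have mC3 : MI.mem R.S (κc * (sgn : ℝ)) (MI.mulInt sc.K sgn) := MI.mem_mulInt hK sgn
  have mdC3x : MI.mem R.S (Real.log 2 * κc * (sgn : ℝ)) (MI.mulInt sc.dK sgn) := MI.mem_mulInt hdK sgn
  have mdC3y : MI.mem R.S (Real.log 2 * κc * ((-sgn : ℤ) : ℝ)) (MI.mulInt sc.dK (-sgn)) := MI.mem_mulInt hdK (-sgn)
  -- the q̂₄ − q̂₅ literal combinations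
  have pq450 := pmem_addI pl40 (pmem_negI pl50)
  have pq451 := pmem_addI pl41 (pmem_negI pl51)
  -- B₀
  have pb0 := pmem_addI (pmem_addI (pmem_smulI hS mC3 (pmem_mulI hS pl30 mS0)) (pmem_mulI hS pq450 mP0))
    (pmem_addI (pmem_smulI hS hC0 (pmem_mulI hS pl00 mM0)) (pmem_smulI hS hCt (pmem_mulI hS plt0 mP0)))
  have pb0' := pmem_smulQI (1 / (legendreLamQ C.ℓ * 2 ^ q.1)) rfl pb0
  -- B_x
  have pT3x := pmem_addI (pmem_smulQI (1 / 2 : ℚ) (rfl : (((1 / 2 : ℚ)) : ℝ) = _) (pmem_mulI hS pl31 mS0)) (pmem_mulI hS pl30 mS1)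
  have pbx := pmem_addI (pmem_addI (pmem_addI (pmem_addI (pmem_smulI hS mC3 pT3x) (pmem_smulI hS mdC3x (pmem_mulI hS pl30 mS0)))
      (pmem_addI (pmem_mulI hS pq451 mP0) (pmem_mulI hS pq450 mP1)))
      (pmem_addI (pmem_smulI hS hdC0 (pmem_mulI hS pl00 mM0)) (pmem_smulI hS hC0 (pmem_mulI hS pl00 mM1))))
      (pmem_smulI hS hCt (pmem_addI (pmem_mulI hS plt1 mP0) (pmem_mulI hS plt0 mP1)))
  have pbx' := pmem_smulQI (1 / (legendreLamQ C.ℓ * 2 ^ q.1)) rfl pbx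
  -- B_y
  have pT3y := pmem_addI (pmem_smulQI (1 / 2 : ℚ) (rfl : (((1 / 2 : ℚ)) : ℝ) = _) (pmem_mulI hS pl31 mS0))
    (pmem_negI (pmem_mulI hS pl30 mS1))
  have pby := pmem_addI (pmem_addI (pmem_addI (pmem_addI (pmem_smulI hS mC3 pT3y) (pmem_smulI hS mdC3y (pmem_mulI hS pl30 mS0)))
      (pmem_negI (pmem_mulI hS pq450 mP1)))
      (pmem_smulI hS hC0 (pmem_negI (pmem_mulI hS pl00 mM1))))
      (pmem_addI (pmem_smulI hS hdCt (pmem_mulI hS plt0 mP0))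
        (pmem_smulI hS hCt (pmem_addI (pmem_negI (pmem_mulI hS plt1 mP0)) (pmem_negI (pmem_mulI hS plt0 mP1)))))
  have pby' := pmem_smulQI (1 / (legendreLamQ C.ℓ * 2 ^ q.1)) rfl pby
  -- the five family remainders
  have hτ : |x - y| ≤ ((R.Wt : ℚ) : ℝ) := by
    unfold OddHeadRowsΔ.Wt; push_cast
    rw [abs_le] at hx hy ⊢; constructor <;> linarith [hx.1, hx.2, hy.1, hy.2]
  have hδb : |(x + y) / 2| ≤ (((R.Wσ + R.Wε) / 2 : ℚ) : ℝ) := by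
    push_cast; rw [abs_le] at hx hy ⊢; constructor <;> linarith [hx.1, hx.2, hy.1, hy.2]
  have hu3 : |Real.log 2 * (x - y)| ≤ (sc.U : ℝ) := by
    rw [abs_mul, abs_of_pos hln2]
    have : |x - y| ≤ 2 * W := by
      rw [abs_le] at hx hy ⊢; constructor <;> linarith [hx.1, hx.2, hy.1, hy.2]
    nlinarith [this, hln2]
  have hu0 : |2 * Real.log 2 * x| ≤ (sc.U : ℝ) := by
    rw [abs_mul, abs_of_pos (by positivity : (0 : ℝ) < 2 * Real.log 2)]
    have : |x| ≤ W := le_trans hx hWs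
    nlinarith [this, hln2]
  have hut : |2 * Real.log 2 * y| ≤ (sc.U : ℝ) := by
    rw [abs_mul, abs_of_pos (by positivity : (0 : ℝ) < 2 * Real.log 2)]
    have : |y| ≤ W := le_trans hy hWe
    nlinarith [this, hln2]
  obtain ⟨r23, hc3, hr23⟩ := scalar_exp_decomp (κc * (sgn : ℝ)) hu3 hU1
  obtain ⟨r20, hc0e, hr20⟩ := scalar_exp_decomp C0c hu0 hU1
  obtain ⟨r2t, hcte, hr2t⟩ := scalar_exp_decomp Ctc hut hU1
  obtain ⟨rr3, prr3, nrr3, bR3⟩ := famRem_sound hS (varies := true) (ρ := ρ) pl30 pl31 pl32 mS0 mS1 mS2 hδb hτ hc3 hu3 hr23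
    (abs_le_aH hS mC3) (fun h => Bool.noConfusion h)
  obtain ⟨rr4, prr4, nrr4, bR4⟩ := famRem_sound hS (varies := false) (U := sc.U) (Cabs := 1) (ρ := ρ)
    (c := (1 : ℝ)) (c0 := 1) (u := 0) (r2 := 0) pl40 pl41 pl42 mP0 mP1 mP2 hx hτ (by ring) (by simpa using hU0)
    (by simp; positivity) (by simp) (fun _ => ⟨rfl, rfl⟩)
  obtain ⟨rr5, prr5, nrr5, bR5⟩ := famRem_sound hS (varies := false) (U := sc.U) (Cabs := 1) (ρ := ρ)
    (c := (1 : ℝ)) (c0 := 1) (u := 0) (r2 := 0) pl50 pl51 pl52 mP0 mP1 mP2 hx hτ (by ring) (by simpa using hU0)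
    (by simp; positivity) (by simp) (fun _ => ⟨rfl, rfl⟩)
  have hδ0 : |(0 : ℝ)| ≤ ((0 : ℚ) : ℝ) := by simp
  obtain ⟨rr0, prr0, nrr0, bR0⟩ := famRem_sound hS (varies := true) (ρ := ρ) pl00 pl01 pl02 mM0 mM1 mM2 hδ0 hτ hc0e hu0 hr20
    (abs_le_aH hS hC0) (fun h => Bool.noConfusion h)
  obtain ⟨rrt, prrt, nrrt, bRt⟩ := famRem_sound hS (varies := true) (ρ := ρ) plt0 plt1 plt2 mP0 mP1 mP2 hτ hτ hcte hut hr2t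
    (abs_le_aH hS hCt) (fun h => Bool.noConfusion h)
  have prs := pmem_addI (pmem_addI (pmem_addI (pmem_addI prr3 prr4) prr5) prr0) prrt
  have prs' := pmem_smulQI (1 / (legendreLamQ C.ℓ * 2 ^ q.1)) rfl prs
  have nrs : ∀ r ∈ smulR ((((1 / (legendreLamQ C.ℓ * 2 ^ q.1)) : ℚ) : ℝ)) (addR (addR (addR (addR rr3 rr4) rr5) rr0) rrt), 0 ≤ r :=
    smulR_nonneg hw0 (addR_nonneg (addR_nonneg (addR_nonneg (addR_nonneg nrr3 nrr4) nrr5) nrr0) nrrt)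
  rw [remAbsR_eq_evalR] at bR3 bR4 bR5 bR0 bRt
  exact ⟨_, _, _, _,
    (by simpa only [term2, proj5_zero, proj5_one, proj5_two, proj5_three, proj5_four] using pb0'),
    (by simpa only [term2, proj5_zero, proj5_one, proj5_two, proj5_three, proj5_four] using pbx'),
    (by simpa only [term2, proj5_zero, proj5_one, proj5_two, proj5_three, proj5_four] using pby'),
    (by simpa only [term2, proj5_zero, proj5_one, proj5_two, proj5_three, proj5_four] using prs'),
    nrs,
    (by
      rw [remAbsR_eq_evalR]
      simp only [evalR_addR, evalR_mulR, evalR_smulR]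
      push_cast
      refine le_of_le_of_eq (abs_comb5 hw0 bR3 bR4 bR5 bR0 bRt ?_) ?_
      · push_cast; ring
      · push_cast; ring)⟩

/-- The real value of ONE merged-2 head term at `(x, y, ρ)` (the expression bounded by `term2_sound`): the weighted sum of the
five family products with the literal orders shifted to the level centre. [folklore] -/
noncomputable def termVal2 (ℓ : ℕ) (ctr : ℚ) (q : ℕ × ℕ) (r3 r4 r5 r0 rt : List ℝ × List ℝ × List ℝ)
    (eS0 eS1 eS2 eP0 eP1 eP2 eM0 eM1 eM2 : List ℝ) (κc C0c Ctc x y ρ : ℝ) : ℝ :=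
  ((1 / (legendreLamQ ℓ * 2 ^ q.1) : ℚ) : ℝ) *
    ((κc * (((-1 : ℤ) ^ ℓ : ℤ) : ℝ) * Real.exp (Real.log 2 * (x - y))) *
        (evalR (shiftR r3.1 (((q.1 : ℚ) + ctr : ℚ) : ℝ)) ρ
          + (x + y) / 2 * evalR (shiftR r3.2.1 (((q.1 : ℚ) + ctr : ℚ) : ℝ)) ρ
          + ((x + y) / 2) ^ 2 * evalR (shiftR r3.2.2 (((q.1 : ℚ) + ctr : ℚ) : ℝ)) ρ) *
        (evalR eS0 ρ + (x - y) * evalR eS1 ρ + (x - y) ^ 2 * evalR eS2 ρ)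
      + ((evalR (shiftR r4.1 (((q.1 : ℚ) + ctr : ℚ) : ℝ)) ρ
          + x * evalR (shiftR r4.2.1 (((q.1 : ℚ) + ctr : ℚ) : ℝ)) ρ
          + x ^ 2 * evalR (shiftR r4.2.2 (((q.1 : ℚ) + ctr : ℚ) : ℝ)) ρ)
        - (evalR (shiftR r5.1 (((q.1 : ℚ) + ctr : ℚ) : ℝ)) ρ
          + x * evalR (shiftR r5.2.1 (((q.1 : ℚ) + ctr : ℚ) : ℝ)) ρ
          + x ^ 2 * evalR (shiftR r5.2.2 (((q.1 : ℚ) + ctr : ℚ) : ℝ)) ρ)) *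
        (evalR eP0 ρ + (x - y) * evalR eP1 ρ + (x - y) ^ 2 * evalR eP2 ρ)
      + (C0c * Real.exp (2 * Real.log 2 * x)) * evalR (shiftR r0.1 (((q.1 : ℚ) + ctr : ℚ) : ℝ)) ρ *
        (evalR eM0 ρ + (x - y) * evalR eM1 ρ + (x - y) ^ 2 * evalR eM2 ρ)
      + (Ctc * Real.exp (2 * Real.log 2 * y)) *
        (evalR (shiftR rt.1 (((q.1 : ℚ) + ctr : ℚ) : ℝ)) ρ
          + (x - y) * evalR (shiftR rt.2.1 (((q.1 : ℚ) + ctr : ℚ) : ℝ)) ρ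
          + (x - y) ^ 2 * evalR (shiftR rt.2.2 (((q.1 : ℚ) + ctr : ℚ) : ℝ)) ρ) *
        (evalR eP0 ρ + (x - y) * evalR eP1 ρ + (x - y) ^ 2 * evalR eP2 ρ))

/-- **Soundness of `slice2`**: summing `term2_sound` over a slice of head terms (data given as functions of the term; all pointwise in
`(x, y, ρ)`). [folklore] -/
theorem slice2_sound {R : OddHeadRowsΔ} (hS : 0 < R.S) {C : EvenCellTM} {TS TP TM : List (List HRTMAB2.TPoly)} {sc : Scal2}
    {Wn : ℤ} {Wd : ℕ}
    {r3 r4 r5 r0 rt : ℕ → List ℝ × List ℝ × List ℝ}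
    (h3 : ∀ q ∈ C.F, PMem3 R.S (r3 q.2) (R.lit q.2).1) (h4 : ∀ q ∈ C.F, PMem3 R.S (r4 q.2) (R.lit q.2).2.1)
    (h5 : ∀ q ∈ C.F, PMem3 R.S (r5 q.2) (R.lit q.2).2.2.1) (h0 : ∀ q ∈ C.F, PMem3 R.S (r0 q.2) (R.lit q.2).2.2.2.1)
    (ht : ∀ q ∈ C.F, PMem3 R.S (rt q.2) (R.lit q.2).2.2.2.2)
    {x y : ℝ} (hx : |x| ≤ R.Wσ) (hy : |y| ≤ R.Wε)
    {eS0 eS1 eS2 eP0 eP1 eP2 eM0 eM1 eM2 : ℕ × ℕ → List ℝ}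
    (mS0 : ∀ q ∈ C.F, PMem R.S (eS0 q) (t3split Wn Wd (rowEntry2 TS C.nF q.1 q.2)).1)
    (mS1 : ∀ q ∈ C.F, PMem R.S (eS1 q) (t3split Wn Wd (rowEntry2 TS C.nF q.1 q.2)).2.1)
    (mS2 : ∀ q ∈ C.F, PMem R.S ((eS2 q).map fun c => |c| * (x - y) ^ 2) (t3split Wn Wd (rowEntry2 TS C.nF q.1 q.2)).2.2)
    (mP0 : ∀ q ∈ C.F, PMem R.S (eP0 q) (t3split Wn Wd (rowEntry2 TP C.nF q.1 q.2)).1)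
    (mP1 : ∀ q ∈ C.F, PMem R.S (eP1 q) (t3split Wn Wd (rowEntry2 TP C.nF q.1 q.2)).2.1)
    (mP2 : ∀ q ∈ C.F, PMem R.S ((eP2 q).map fun c => |c| * (x - y) ^ 2) (t3split Wn Wd (rowEntry2 TP C.nF q.1 q.2)).2.2)
    (mM0 : ∀ q ∈ C.F, PMem R.S (eM0 q) (t3split Wn Wd (rowEntry2 TM C.nF q.1 q.2)).1)
    (mM1 : ∀ q ∈ C.F, PMem R.S (eM1 q) (t3split Wn Wd (rowEntry2 TM C.nF q.1 q.2)).2.1)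
    (mM2 : ∀ q ∈ C.F, PMem R.S ((eM2 q).map fun c => |c| * (x - y) ^ 2) (t3split Wn Wd (rowEntry2 TM C.nF q.1 q.2)).2.2)
    {κc C0c Ctc : ℝ} (hK : MI.mem R.S κc sc.K) (hdK : MI.mem R.S (Real.log 2 * κc) sc.dK)
    (hC0 : MI.mem R.S C0c sc.C0) (hdC0 : MI.mem R.S (2 * Real.log 2 * C0c) sc.dC0x)
    (hCt : MI.mem R.S Ctc sc.Ct) (hdCt : MI.mem R.S (2 * Real.log 2 * Ctc) sc.dCty)
    {W : ℝ} (hWs : (R.Wσ : ℝ) ≤ W) (hWe : (R.Wε : ℝ) ≤ W) (hU : 2 * W * Real.log 2 ≤ sc.U) (hU1 : (sc.U : ℝ) ≤ 1)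
    (ρ : ℝ) :
    ∀ qs : List (ℕ × ℕ), (∀ q ∈ qs, q ∈ C.F) →
      ∃ b0s bxs bys rs : List ℝ,
        PMem R.S b0s (slice2 R C TS TP TM sc Wn Wd qs).1 ∧ PMem R.S bxs (slice2 R C TS TP TM sc Wn Wd qs).2.1 ∧
        PMem R.S bys (slice2 R C TS TP TM sc Wn Wd qs).2.2.1 ∧ PMem R.S rs (slice2 R C TS TP TM sc Wn Wd qs).2.2.2 ∧
        (∀ r ∈ rs, 0 ≤ r) ∧
        |(qs.map fun q => termVal2 C.ℓ C.ctr q (r3 q.2) (r4 q.2) (r5 q.2) (r0 q.2) (rt q.2)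
            (eS0 q) (eS1 q) (eS2 q) (eP0 q) (eP1 q) (eP2 q) (eM0 q) (eM1 q) (eM2 q) κc C0c Ctc x y ρ).sum
          - (evalR b0s ρ + x * evalR bxs ρ + y * evalR bys ρ)| ≤ remAbsR rs |ρ|
  | [], _ => ⟨[], [], [], [], by simp [slice2, pmem_nil], by simp [slice2, pmem_nil], by simp [slice2, pmem_nil],
      by simp [slice2, pmem_nil], by simp, by simp [remAbsR]⟩
  | q :: qs, hqs => by
      have hq : q ∈ C.F := hqs q (by simp)
      obtain ⟨b0', bx', by', rs', p0', px', py', pr', nn', bd'⟩ :=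
        slice2_sound hS h3 h4 h5 h0 ht hx hy mS0 mS1 mS2 mP0 mP1 mP2 mM0 mM1 mM2 hK hdK hC0 hdC0 hCt hdCt hWs hWe hU hU1 ρ
          qs (fun q' hq' => hqs q' (by simp [hq']))
      obtain ⟨b0, bx, by_, rs, p0, px, py, pr, nn, bd⟩ :=
        term2_sound hS (q := q) (h3 q hq) (h4 q hq) (h5 q hq) (h0 q hq) (ht q hq) hx hy
          (mS0 q hq) (mS1 q hq) (mS2 q hq) (mP0 q hq) (mP1 q hq) (mP2 q hq) (mM0 q hq) (mM1 q hq) (mM2 q hq)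
          hK hdK hC0 hdC0 hCt hdCt hWs hWe hU hU1 ρ
      refine ⟨addR b0 b0', addR bx bx', addR by_ by', addR rs rs', ?_, ?_, ?_, ?_, addR_nonneg nn nn', ?_⟩
      · simp only [slice2]; exact pmem_addI p0 p0'
      · simp only [slice2]; exact pmem_addI px px'
      · simp only [slice2]; exact pmem_addI py py'
      · simp only [slice2]; exact pmem_addI pr pr'
      · rw [remAbsR_eq_evalR] at bd bd' ⊢
        simp only [List.map_cons, List.sum_cons, evalR_addR]
        have e : ∀ (t s B Bx By B' Bx' By' : ℝ),
            t + s - (B + B' + x * (Bx + Bx') + y * (By + By')) = (t - (B + x * Bx + y * By)) + (s - (B' + x * Bx' + y * By')) :=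
          fun _ _ _ _ _ _ _ _ => by ring
        rw [e]
        exact le_trans (abs_add_le _ _) (add_le_add bd bd')

end HeadParts2

end Summit.CriticalPhenomena.Ising3D
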